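import Mathlib
import HarnessLib
import Literature.MathematicalPhysics.QuantumLattice.HubbardGridCounterQuadratic
import Literature.MathematicalPhysics.QuantumLattice.HubbardSpaceTimeCharacters
import Summits.HubbardSuperconductivity.HubbardSuperconductivity.Theorems.KLProgrammeKLRegimeCountertermJacksonCoeffContraction

/-!
# Route `KLProgramme` — located risk #9 «(b)-GRID-FRAME-M1», model lemma (M1-a): the position FIRST MOMENT of a frame's lattice kernel is
# bounded by its coefficient weight `coeffNorm 1`, and Jackson smoothing does not increase it (coefficient damping)

Cell `gate-hubbard-kl`, seat hubbard-kl-k3c3-p3 (g8; row «implicit-function / monotonicity route for μ(n)»); engine-flow child `KLRegimeEngineV17F2`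
(stmt-HubbardSuperconductivity-20437), located risk #9 (KL STATUS l.3628/l.3632 (R59am), assignment l.3647 (R59ar)): the grid atom's SPACE row reads
`M₁(K) = Σ_z ‖Ǩ_L(z)‖·(1 + |z|_∞)` of the flow frame, and the flow pieces are Jackson means `jacksonFrame (klFlowDeg m) (klFrameExtFn μ ν_m)`.
* §1 `torusSiteDist_harmonicShift_zero_le`: the eight lattice sites carried by the harmonic `h_{m,n}` lie within `ℓ^∞`-torus-distance `m + n` of `0`
  (`|valMinAbs (±k : ZMod L)| ≤ k`, any `L ≥ 1`);
* §2 `sum_norm_harmonicPosKernel_mul_weight_le` (`Σ_z ‖ȟ_{m,n}(z)‖(1 + |z|) ≤ 1 + m + n`) and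
  **`sum_norm_framePosKernel_mul_weight_le_coeffNorm_one`**: `Σ_z ‖Ǩ_L(z)‖·(1 + torusSiteDist z 0) ≤ coeffNorm 1 K` — every `L`, every degree, no
  aliasing condition (the companion of `sum_norm_framePosKernel_le … ≤ coeffNorm 0 K`);
* §3 **`coeffNorm_jacksonFrame_le_cosMoments`**: `coeffNorm r (jacksonFrame d F) ≤ Σ_{k,l ≤ 2d} (1+k+l)^r·|cosMoment F k l|/(cosNorm k·cosNorm l)` for ANY
  function `F` on the zone — the Jackson multipliers `ĵ_k·cosNorm k ∈ [0, 1]` (`abs_jhat_le_one`) DAMP the double-cosine coefficients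
  `cosMoment F k l/(cosNorm k cosNorm l)` of `F` termwise (k3c3-p2's `coeffNorm_jacksonFrame_eval_le` is the case `F = G.eval`); hence (M1-a)
  **`sum_norm_framePosKernel_jacksonFrame_mul_weight_le`**: `M₁(jacksonFrame d F) ≤ Σ_{k,l ≤ 2d} (1+k+l)·|cosMoment F k l|/(cosNorm k·cosNorm l)` —
  «M₁ is non-increasing under Jackson smoothing», measured against the truncated first moment of `F`'s own double-cosine coefficients.
(M1-b) — the first coefficient moment of the tube extension `klFrameExtFn μ g` against the angular profile `g` — is a CURVATURE statement (memo
HOME/hubbard-kl-k3c3-p3/RISK9-M1.md): not in this file.  Pure bookkeeping on landed objects; no definitions; nothing about the Hubbard model.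
-/

noncomputable section

namespace Summit.HubbardSuperconductivity.HubbardSuperconductivity.Theorems.KLRegimeSplit

set_option linter.dupNamespace false -- summit = problem name (single-conjunct summit), D-0017

open Real Finset Literature.MathematicalPhysics.QuantumLattice Literature.Probability.LatticeModels

variable {L : ℕ} [NeZero L]

/-! ## §1 The harmonic's eight sites are within distance `m + n` of the origin -/

/-- `|valMinAbs (±k : ZMod L)| ≤ k` (as a real number). -/
theorem abs_valMinAbs_signedNatCast_le (s : Fin 2) (k : ℕ) :
    |((((if s = 0 then (k : ZMod L) else -(k : ZMod L)) : ZMod L).valMinAbs : ℤ) : ℝ)| ≤ k := by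
  have hk : ((k : ZMod L).valMinAbs).natAbs ≤ k := by
    rw [ZMod.valMinAbs_natAbs_eq_min, ZMod.val_natCast]
    exact (min_le_left _ _).trans (Nat.mod_le _ _)
  have h : (((if s = 0 then (k : ZMod L) else -(k : ZMod L)) : ZMod L).valMinAbs).natAbs ≤ k := by
    split_ifs
    · exact hk
    · rw [ZMod.natAbs_valMinAbs_neg]; exact hk
  have h' := (Nat.cast_le (α := ℝ)).2 h
  rwa [Nat.cast_natAbs, Int.cast_abs] at h'

/-- **The sites of `h_{m,n}` are near the origin**: `torusSiteDist (harmonicShift L m n e) 0 ≤ m + n` for each of the eight signed/swapped shifts. -/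
theorem torusSiteDist_harmonicShift_zero_le (m n : ℕ) (e : Fin 2 × Fin 2 × Fin 2) :
    torusSiteDist (harmonicShift L m n e) 0 ≤ (m : ℝ) + n := by
  refine (torusSiteDist_le_abs_add_abs _ _).trans ?_
  rw [sub_zero]
  rcases e with ⟨s, t, u⟩
  by_cases hu : u = 0
  · have h0 : harmonicShift L m n (s, t, u) 0 = (if s = 0 then (m : ZMod L) else -(m : ZMod L)) := by simp [harmonicShift, hu]
    have h1 : harmonicShift L m n (s, t, u) 1 = (if t = 0 then (n : ZMod L) else -(n : ZMod L)) := by simp [harmonicShift, hu]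
    rw [h0, h1]
    exact add_le_add (abs_valMinAbs_signedNatCast_le s m) (abs_valMinAbs_signedNatCast_le t n)
  · have h0 : harmonicShift L m n (s, t, u) 0 = (if s = 0 then (n : ZMod L) else -(n : ZMod L)) := by simp [harmonicShift, hu]
    have h1 : harmonicShift L m n (s, t, u) 1 = (if t = 0 then (m : ZMod L) else -(m : ZMod L)) := by simp [harmonicShift, hu]
    rw [h0, h1, add_comm (m : ℝ)]
    exact add_le_add (abs_valMinAbs_signedNatCast_le s n) (abs_valMinAbs_signedNatCast_le t m)

/-! ## §2 The weighted `ℓ¹` size of the position kernels -/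

/-- `Σ_z ‖ȟ_{m,n}(z)‖·(1 + |z|) ≤ 1 + m + n` (eight deltas of weight `⅛` at sites within distance `m + n`). -/
theorem sum_norm_harmonicPosKernel_mul_weight_le (m n : ℕ) :
    ∑ z : TorusSite 2 L, ‖harmonicPosKernel L m n z‖ * (1 + torusSiteDist z 0) ≤ 1 + m + n := by
  have hpt : ∀ z : TorusSite 2 L, ‖harmonicPosKernel L m n z‖ * (1 + torusSiteDist z 0) ≤
      (8 : ℝ)⁻¹ * ∑ e : Fin 2 × Fin 2 × Fin 2, (if z = harmonicShift L m n e then (1 + (m : ℝ) + n) else 0) := by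
    intro z
    have hd : 0 ≤ torusSiteDist z 0 := by unfold torusSiteDist; exact Nat.cast_nonneg _
    rw [harmonicPosKernel_eq, norm_mul, norm_inv, RCLike.norm_ofNat, mul_assoc]
    refine mul_le_mul_of_nonneg_left ?_ (by norm_num)
    calc ‖∑ e : Fin 2 × Fin 2 × Fin 2, (if z = harmonicShift L m n e then (1 : ℂ) else 0)‖ * (1 + torusSiteDist z 0)
        ≤ (∑ e : Fin 2 × Fin 2 × Fin 2, ‖(if z = harmonicShift L m n e then (1 : ℂ) else 0)‖) * (1 + torusSiteDist z 0) :=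
          mul_le_mul_of_nonneg_right (norm_sum_le _ _) (by linarith)
      _ = ∑ e : Fin 2 × Fin 2 × Fin 2, ‖(if z = harmonicShift L m n e then (1 : ℂ) else 0)‖ * (1 + torusSiteDist z 0) := sum_mul _ _ _
      _ ≤ _ := sum_le_sum fun e _ => ?_
    split_ifs with h
    · rw [norm_one, one_mul, h]
      linarith [torusSiteDist_harmonicShift_zero_le (L := L) m n e]
    · simp
  calc ∑ z : TorusSite 2 L, ‖harmonicPosKernel L m n z‖ * (1 + torusSiteDist z 0)
      ≤ ∑ z : TorusSite 2 L, (8 : ℝ)⁻¹ * ∑ e : Fin 2 × Fin 2 × Fin 2, (if z = harmonicShift L m n e then (1 + (m : ℝ) + n) else 0) :=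
        sum_le_sum fun z _ => hpt z
    _ = (8 : ℝ)⁻¹ * ∑ e : Fin 2 × Fin 2 × Fin 2, ∑ z : TorusSite 2 L, (if z = harmonicShift L m n e then (1 + (m : ℝ) + n) else 0) := by
        rw [← mul_sum, sum_comm]
    _ = (8 : ℝ)⁻¹ * ∑ _e : Fin 2 × Fin 2 × Fin 2, (1 + (m : ℝ) + n) := by
        congr 1
        refine sum_congr rfl fun e _ => ?_
        rw [sum_ite_eq' univ (harmonicShift L m n e) (fun _ => (1 + (m : ℝ) + n)), if_pos (mem_univ _)]
    _ = 1 + m + n := by simp; ring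

/-- **`Σ_z ‖Ǩ_L(z)‖·(1 + |z|_∞) ≤ coeffNorm 1 K`** for every `L ≥ 1` and every degree: the position FIRST MOMENT of a frame's lattice kernel is at
most its first coefficient weight `Σ_{m,n ≤ d} (1 + m + n)|κ_{m,n}|` (each harmonic contributes `≤ 1 + m + n`; no volume factor, no condition
`L > 2·degree`).  [cite: BenfattoGiulianiMastropietro2003, §1.2 The model (2.10)] -/
theorem sum_norm_framePosKernel_mul_weight_le_coeffNorm_one (K : TrigPolyC4v) :
    ∑ z : TorusSite 2 L, ‖framePosKernel L K z‖ * (1 + torusSiteDist z 0) ≤ K.coeffNorm 1 := by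
  simp_rw [framePosKernel_eq_sum]
  have hd : ∀ z : TorusSite 2 L, 0 ≤ 1 + torusSiteDist z 0 := fun z => by
    have : 0 ≤ torusSiteDist z 0 := by unfold torusSiteDist; exact Nat.cast_nonneg _
    linarith
  calc ∑ z : TorusSite 2 L, ‖∑ m ∈ range (K.degree + 1), ∑ n ∈ range (K.degree + 1), (K.coeff m n : ℂ) * harmonicPosKernel L m n z‖ *
        (1 + torusSiteDist z 0)
      ≤ ∑ z : TorusSite 2 L, ∑ m ∈ range (K.degree + 1), ∑ n ∈ range (K.degree + 1),
          |K.coeff m n| * (‖harmonicPosKernel L m n z‖ * (1 + torusSiteDist z 0)) := by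
        refine sum_le_sum fun z _ => ?_
        rw [← sum_mul_weight_helper K z]
        refine mul_le_mul_of_nonneg_right ((norm_sum_le _ _).trans (sum_le_sum fun m _ => (norm_sum_le _ _).trans
          (sum_le_sum fun n _ => ?_))) (hd z)
        rw [norm_mul, Complex.norm_real, Real.norm_eq_abs]
    _ = ∑ m ∈ range (K.degree + 1), ∑ n ∈ range (K.degree + 1),
          |K.coeff m n| * ∑ z : TorusSite 2 L, ‖harmonicPosKernel L m n z‖ * (1 + torusSiteDist z 0) := by
        rw [sum_comm]
        refine sum_congr rfl fun m _ => ?_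
        rw [sum_comm]
        refine sum_congr rfl fun n _ => ?_
        rw [mul_sum]
    _ ≤ ∑ m ∈ range (K.degree + 1), ∑ n ∈ range (K.degree + 1), |K.coeff m n| * (1 + m + n) :=
        sum_le_sum fun m _ => sum_le_sum fun n _ =>
          mul_le_mul_of_nonneg_left (sum_norm_harmonicPosKernel_mul_weight_le m n) (abs_nonneg _)
    _ = K.coeffNorm 1 := by
        simp only [TrigPolyC4v.coeffNorm, pow_one]
        exact sum_congr rfl fun m _ => sum_congr rfl fun n _ => by ring
  where
  /-- distributing the weight over the double coefficient sum (plumbing) -/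
  sum_mul_weight_helper (K : TrigPolyC4v) (z : TorusSite 2 L) :
      (∑ m ∈ range (K.degree + 1), ∑ n ∈ range (K.degree + 1), |K.coeff m n| * ‖harmonicPosKernel L m n z‖) * (1 + torusSiteDist z 0) =
        ∑ m ∈ range (K.degree + 1), ∑ n ∈ range (K.degree + 1), |K.coeff m n| * (‖harmonicPosKernel L m n z‖ * (1 + torusSiteDist z 0)) := by
    rw [sum_mul]
    refine sum_congr rfl fun m _ => ?_
    rw [sum_mul]
    exact sum_congr rfl fun n _ => by ring

/-! ## §3 Jackson smoothing damps the coefficients: (M1-a) -/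

/-- **The coefficient weights of a Jackson mean are dominated by the function's own double-cosine coefficients**: for ANY `F` and every `r`,
`coeffNorm r (jacksonFrame d F) ≤ Σ_{k,l ≤ 2d} (1+k+l)^r·|cosMoment F k l|/(cosNorm k·cosNorm l)` — the multipliers `ĵ_k·cosNorm k` lie in
`[0, 1]` (`abs_jhat_le_one`: the Jackson kernel is non-negative of mass one). -/
theorem coeffNorm_jacksonFrame_le_cosMoments (d : ℕ) (F : (Fin 2 → ℝ) → ℝ) (r : ℕ) :
    (jacksonFrame d F).coeffNorm r ≤
      ∑ k ∈ range (d + d + 1), ∑ l ∈ range (d + d + 1), (1 + k + l : ℝ) ^ r * (|cosMoment F k l| / (cosNorm k * cosNorm l)) := by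
  unfold TrigPolyC4v.coeffNorm jacksonFrame
  refine sum_le_sum fun k _ => sum_le_sum fun l _ => mul_le_mul_of_nonneg_left ?_ (by positivity)
  have hk := cosNorm_pos k
  have hl := cosNorm_pos l
  have hjk := abs_jhat_le_one d k
  have hjl := abs_jhat_le_one d l
  rw [abs_mul, abs_mul, le_div_iff₀ (mul_pos hk hl)]
  have e : |jkerCoeff d k| * |jkerCoeff d l| * |cosMoment F k l| * (cosNorm k * cosNorm l) =
      |jkerCoeff d k * cosNorm k| * |jkerCoeff d l * cosNorm l| * |cosMoment F k l| := by
    rw [abs_mul, abs_mul, abs_of_pos hk, abs_of_pos hl]; ring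
  rw [e]
  have h0 : 0 ≤ |cosMoment F k l| := abs_nonneg _
  calc |jkerCoeff d k * cosNorm k| * |jkerCoeff d l * cosNorm l| * |cosMoment F k l|
      ≤ 1 * 1 * |cosMoment F k l| := by gcongr
    _ = |cosMoment F k l| := by ring

/-- **(M1-a) «M₁ IS NON-INCREASING UNDER JACKSON SMOOTHING».**  For ANY function `F` on the zone, any order `d` and any `L ≥ 1`:
`Σ_z ‖Ǩ_L(jacksonFrame d F)(z)‖·(1 + |z|_∞) ≤ Σ_{k,l ≤ 2d} (1+k+l)·|cosMoment F k l|/(cosNorm k·cosNorm l)` — the position first moment of the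
smoothed piece is at most the (truncated) first moment of `F`'s own double-cosine coefficient table `cosMoment F k l/(cosNorm k cosNorm l)`
(no aliasing term: the smoothed object is a `TrigPolyC4v`, its lattice kernel is read off the coefficients). -/
theorem sum_norm_framePosKernel_jacksonFrame_mul_weight_le (d : ℕ) (F : (Fin 2 → ℝ) → ℝ) :
    ∑ z : TorusSite 2 L, ‖framePosKernel L (jacksonFrame d F) z‖ * (1 + torusSiteDist z 0) ≤
      ∑ k ∈ range (d + d + 1), ∑ l ∈ range (d + d + 1), (1 + k + l : ℝ) * (|cosMoment F k l| / (cosNorm k * cosNorm l)) := by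
  refine (sum_norm_framePosKernel_mul_weight_le_coeffNorm_one (L := L) (jacksonFrame d F)).trans ?_
  have h := coeffNorm_jacksonFrame_le_cosMoments d F 1
  simp only [pow_one] at h
  exact h

/-- The plain `ℓ¹` companion: `Σ_z ‖Ǩ_L(jacksonFrame d F)(z)‖ ≤ Σ_{k,l ≤ 2d} |cosMoment F k l|/(cosNorm k·cosNorm l)`. -/
theorem sum_norm_framePosKernel_jacksonFrame_le (d : ℕ) (F : (Fin 2 → ℝ) → ℝ) :
    ∑ z : TorusSite 2 L, ‖framePosKernel L (jacksonFrame d F) z‖ ≤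
      ∑ k ∈ range (d + d + 1), ∑ l ∈ range (d + d + 1), |cosMoment F k l| / (cosNorm k * cosNorm l) := by
  refine (sum_norm_framePosKernel_le (L := L) (jacksonFrame d F)).trans ?_
  have h := coeffNorm_jacksonFrame_le_cosMoments d F 0
  simp only [pow_zero, one_mul] at h
  exact h

end Summit.HubbardSuperconductivity.HubbardSuperconductivity.Theorems.KLRegimeSplit

end
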